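import Summits.Ventures.Crystal3D.Theorems.StickyWulffConstantGenericWallFloorSaturationStructure
import Summits.Ventures.Crystal3D.Theorems.StickyWulffConstantGenericWallFloorExitTwinCap
import HarnessLib

/-!
# Exit trichotomy for general fillings: pay within contact distance three, or be an exact twin cap

HONEST FRAMING. Part of the venture `Summits/Ventures/Crystal3D` (cell `crystal3d-full`), helper for the
crux `GenericWallFloor` (stmt-Ventures-19480) of `route-Ventures-StickyWulffConstant`, REGISTERED line
`WallLedgerG` (planner cf-p1 gen 16), stub `stub_twoSlabAdhesion : TwoSlabAdhesion` (THE CRUX of the line).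
Composition of the two general-filling bricks `…SaturationStructure` (Barlow patch from radius-three
saturation, under the NAMED inputs `KissingGap δ`, `KissingClassification δ` — tree theorems at `δ = 5/2`)
and `…ExitTwinCap` (the patch form of the exit lemma).  Rung credit only; F-C1 not moved.

**Theorem (`exit_trichotomy`) — the per-ball lemma of the slot ledger for GENERAL fillings, final local
form (no cell, no plates, no `ρ`, arbitrary foreign balls).**  Let `X` be a finite `1`-separated
configuration, `A` a linear isometry, `d ∈ X` a ball with its full shell `d + A w ∈ X` (`w ∈ fccSlots`),
`u` a slot, `e = d + A u`, and suppose some slot of `e` is empty.  Then EITHER some ball of `X` within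
contact distance `3` of `e` (possibly `e` itself) has fewer than twelve contacts — the line end PAYS, at
bounded distance — OR `e` is an exact twin cap over `d` (a `{111}` layer normal `n` of the grain with
`⟪A u, n⟫ = √(2/3)`, the nine near/in-plane slots occupied, the three far slots empty and their mirror
images occupied).  `exit_trichotomy_250` is the instance at the tree's gap `δ = 5/2`, still with the two
named inputs as hypotheses (discharge them with `kissingClassification_250` and the `KissingGap (5/2)`
obtained from `gapTupleDiam_125`, both COMPUTATIONAL grade, when a hypothesis-free corollary is wanted).

WHAT THIS IS NOT: not the stub (the areal bookkeeping of exits — monotone Barlow lines — is the next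
step); F-C1 not moved.
-/

noncomputable section

namespace Summit.Ventures.Crystal3D.Theorems

open Summit.Ventures.Crystal3D Finset
open Literature.MathematicalPhysics.StatisticalMechanics (fccStacking barlowStacking IsHaggSeq)
open scoped InnerProductSpace

variable {X : Finset (EuclideanSpace ℝ (Fin 3))}

/-- **Exit trichotomy** (see the module docstring). -/
theorem exit_trichotomy {δ : ℝ} (hg : KissingGap δ) (hc : KissingClassification δ)
    (hX : ∀ p ∈ X, ∀ q ∈ X, p ≠ q → 1 ≤ dist p q)
    (A : EuclideanSpace ℝ (Fin 3) ≃ₗᵢ[ℝ] EuclideanSpace ℝ (Fin 3)) {d : EuclideanSpace ℝ (Fin 3)}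
    (hd : d ∈ X) (hfull : ∀ w ∈ fccSlots, d + A w ∈ X) {u : EuclideanSpace ℝ (Fin 3)} (hu : u ∈ fccSlots)
    (hv : ∃ v ∈ fccSlots, d + A u + A v ∉ X) :
    (∃ y ∈ X, (y = d + A u ∨ dist (d + A u) y = 1 ∨ (∃ z ∈ X, dist (d + A u) z = 1 ∧ dist z y = 1) ∨
        ∃ z ∈ X, ∃ z' ∈ X, dist (d + A u) z = 1 ∧ dist z z' = 1 ∧ dist z' y = 1) ∧
      (X.filter fun q => dist y q = 1).card ≠ 12) ∨
    ∃ n : EuclideanSpace ℝ (Fin 3), ‖n‖ = 1 ∧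
      (∀ w ∈ fccSlots, ⟪A w, n⟫_ℝ = 0 ∨ ⟪A w, n⟫_ℝ = Real.sqrt (2 / 3) ∨ ⟪A w, n⟫_ℝ = -Real.sqrt (2 / 3)) ∧
      ⟪A u, n⟫_ℝ = Real.sqrt (2 / 3) ∧
      (∀ w ∈ fccSlots, ⟪A w, n⟫_ℝ ≤ 0 → d + A u + A w ∈ X) ∧
      (∀ w ∈ fccSlots, 0 < ⟪A w, n⟫_ℝ →
        d + A u + A w ∉ X ∧ d + A u - A w + (2 * ⟪A w, n⟫_ℝ) • n ∈ X) := by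
  classical
  by_cases hsat : ∀ y ∈ X,
      (y = d + A u ∨ dist (d + A u) y = 1 ∨ (∃ z ∈ X, dist (d + A u) z = 1 ∧ dist z y = 1) ∨
        ∃ z ∈ X, ∃ z' ∈ X, dist (d + A u) z = 1 ∧ dist z z' = 1 ∧ dist z' y = 1) →
      (X.filter fun q => dist y q = 1).card = 12
  · right
    have heX : d + A u ∈ X := hfull u hu
    obtain ⟨σ, hσ, L, s, hpatch⟩ := barlowPatch_of_saturated_withinThree hg hc hX heX hsat
    exact exit_twinCap_of_patch A hd hfull hu (hsat _ heX (Or.inl rfl)) hv hσ L s hpatch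
  · left
    push Not at hsat
    obtain ⟨y, hy, hwy, hne⟩ := hsat
    exact ⟨y, hy, hwy, hne⟩

/-- **Exit trichotomy at the tree's gap `δ = 5/2`** (inputs `KissingGap (5/2)`, `KissingClassification (5/2)`
by name; both are tree theorems of computational grade). -/
theorem exit_trichotomy_250 (hg : KissingGap (5 / 2)) (hc : KissingClassification (5 / 2))
    (hX : ∀ p ∈ X, ∀ q ∈ X, p ≠ q → 1 ≤ dist p q)
    (A : EuclideanSpace ℝ (Fin 3) ≃ₗᵢ[ℝ] EuclideanSpace ℝ (Fin 3)) {d : EuclideanSpace ℝ (Fin 3)}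
    (hd : d ∈ X) (hfull : ∀ w ∈ fccSlots, d + A w ∈ X) {u : EuclideanSpace ℝ (Fin 3)} (hu : u ∈ fccSlots)
    (hv : ∃ v ∈ fccSlots, d + A u + A v ∉ X) :
    (∃ y ∈ X, (y = d + A u ∨ dist (d + A u) y = 1 ∨ (∃ z ∈ X, dist (d + A u) z = 1 ∧ dist z y = 1) ∨
        ∃ z ∈ X, ∃ z' ∈ X, dist (d + A u) z = 1 ∧ dist z z' = 1 ∧ dist z' y = 1) ∧
      (X.filter fun q => dist y q = 1).card ≠ 12) ∨
    ∃ n : EuclideanSpace ℝ (Fin 3), ‖n‖ = 1 ∧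
      (∀ w ∈ fccSlots, ⟪A w, n⟫_ℝ = 0 ∨ ⟪A w, n⟫_ℝ = Real.sqrt (2 / 3) ∨ ⟪A w, n⟫_ℝ = -Real.sqrt (2 / 3)) ∧
      ⟪A u, n⟫_ℝ = Real.sqrt (2 / 3) ∧
      (∀ w ∈ fccSlots, ⟪A w, n⟫_ℝ ≤ 0 → d + A u + A w ∈ X) ∧
      (∀ w ∈ fccSlots, 0 < ⟪A w, n⟫_ℝ →
        d + A u + A w ∉ X ∧ d + A u - A w + (2 * ⟪A w, n⟫_ℝ) • n ∈ X) :=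
  exit_trichotomy hg hc hX A hd hfull hu hv

end Summit.Ventures.Crystal3D.Theorems

end
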